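import Summits.Langlands.Langlands.Theses.OrdinaryPrimeTransport
import Literature.NumberTheory.Automorphic.KimShahidiSymmetricPowers
import HarnessLib

/-!
# SKELETON — line `BianchiSymmPowerGaloisToAutomorphic` for the crux `ReciprocityUpToIrreducibility`
# (item stmt-Langlands-14328; routes IrreducibilityBySelfDuality / OrdinaryPrimeTransport)
# forward generator G4 ladder-down, generation 29 (unit fwd2-ladder-Langlands-14328-g29)

PUBLICATION NOTE.  The crux item stmt-Langlands-14328 is ONE statement carried verbatim by both route files
(`Iff.rfl`-equal decls `Summit.Langlands.Langlands.Theses.IrreducibilityBySelfDuality.ReciprocityUpToIrreducibility`,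
primary, and `Summit.Langlands.Langlands.Theses.OrdinaryPrimeTransport.ReciprocityUpToIrreducibility`).  This PUBLISHED
copy imports `Theses.OrdinaryPrimeTransport` only and concludes the OPT decl by name, because the crux-workfile farm lane
answered "remote:incoherent … Theses.IrreducibilityBySelfDuality: mismatch" on 2026-08-20 (as for g25–g28).  The seat's
REGISTRATION copy (identical stubs, the four `@[stub "BianchiSymmPowerGaloisToAutomorphic"]` tags live — crux workfiles
carry no gate-reserved attributes) imports BOTH route modules, proves the two decls interchangeable by `Iff.rfl`, and
concludes the primary IBSD decl (`ReciprocityUpToIrreducibility_of`) as well as this one (`…_of_opt`);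
`ledger skeleton check … --crux stmt-Langlands-14328`.

DIAL θ31 = the CLASS OF BASE FIELDS over which ALL symmetric powers `Symᵐ`, `m ≥ 1`, of the REGULAR ALGEBRAIC
cuspidal automorphic representations of `GL₂` are automorphic — read inside clause (B) of the top (Galois →
automorphic, a.e.-Satake form): for `π` regular algebraic cuspidal on `GL₂(𝔸_K)` and an IRREDUCIBLE `ρ : Γ_K →
GL_{m+1}(ℚ̄_ℓ)`, de Rham above `ℓ`, whose Frobenius polynomials are a.e. the `ι`-Satake polynomials of
`Symᵐ(Satake(π_v))`, an automorphic `P` on `GL_{m+1}(𝔸_K)` a.e. Satake–Frobenius compatible with `ρ` exists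
(family `SymmPowerRAGaloisToAutomorphicOn 𝒦`; a bigger class `𝒦` is a stronger statement, `…_mono`).

* FLOOR `𝒦₀ =` totally real fields: Newton–Thorne, *Symmetric power functoriality for Hilbert modular forms*
  (arXiv:2212.03595, Thm. A p. 3 + footnote 1 for the CM case; the `K = ℚ` cell is Newton–Thorne 2021 I/II, in
  tree as the `L²`-model fact `NewtonThorne2021_exists_cuspidal_symmPowerLift`), datum-model a.e. rendering
  `NewtonThorne2022SymmPowerText`; bridge `floor_newtonThorne : NewtonThorne2022SymmPowerText →
  SymmPowerRAGaloisToAutomorphicOn TotallyRealClass` (sorry-free).  Side floors BESIDE the chain: `m ≤ 4` over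
  EVERY number field and every cuspidal `π` (Gelbart–Jacquet / Kim–Shahidi / Kim, in tree:
  `weakSymmPowerFunctoriality_one`, `weakSymmPowerFunctoriality_two_of_GelbartJacquet`,
  `KimShahidi2002_symmCube_automorphic`, `Kim2003_symmFourth_automorphic`) via `sectorB_of_weakSymmPowerFunctoriality`.
* RUNG `𝒦₁ =` totally real OR imaginary quadratic (= `BianchiSymmPowerGaloisToAutomorphic`): the new cell is the
  BIANCHI one — `Symᵐ`, all `m ≥ 5`, of regular algebraic cuspidal `π` on `GL₂` over an imaginary quadratic `K`
  (for `π` not a twist of a base change only POTENTIAL automorphy of `Symᵐ r_{π,λ}` is known: Boxer–Calegari–Gee–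
  Newton–Thorne, arXiv:2309.15880, Thm. 7.2.1 / Thm. C).  OPEN.  LOCATED STOP: Newton–Thorne prove `Symᵐ`-automorphy
  by (i) a "seed" point and (ii) ANALYTIC CONTINUATION of the automorphy of `Symᵐ` along irreducible components of
  the `GL₂`-eigenvariety, which needs the eigenvariety to be equidimensional of the dimension of weight space and
  built from DEFINITE unitary groups / POLARIZABLE Galois representations (their Thm. 2.1 / 2.33); over an imaginary
  quadratic `K` the Bianchi eigenvariety has components of dimension 1 < 2 = dim weight space with finitely many
  classical points (Calegari–Mazur; Hida), `Symᵐ r_π` is not polarizable, and the only automorphy lifting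
  theorems are the defect-positive ones of the 10-author paper / BCGNT (Thm. 3.2.1), which give automorphy over `K`
  only from RESIDUAL automorphy over `K` — available in print only over an extension `K'/K` (p-q-r switch).
* HIGHER RUNGS: all CM fields; all number fields (no method) — ONE complement stub `stub_higherRungs`.
* ON-PATH: `Langlands → SymmPowerRAGaloisToAutomorphicOn 𝒦` for every class (clause (B) at rank `m+1`), hence
  `Langlands → rung`; and `E → rung` for the crux E itself.
* COMPOSITION `ReciprocityUpToIrreducibility_of : rung → higherRungs → sectorMerge → offSector → E` BY NAME.
Sorries ONLY inside the four `stub_*`.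
-/

noncomputable section

set_option linter.dupNamespace false

open scoped MatrixGroups Matrix NumberField Classical Polynomial
open Filter IsDedekindDomain Field Polynomial
open Literature.NumberTheory.Automorphic Literature.NumberTheory.GaloisRepresentations
open Literature.NumberTheory.PAdicHodge
open Summit.Langlands

namespace Summit.Langlands.Langlands.Cruxes.ReciprocityUpToIrreducibility.BianchiSymmPowerGaloisToAutomorphic

/-! ## 1. The dial: classes of number fields -/

/-- The class of totally real number fields (the floor's class). [folklore] -/
def TotallyRealClass : ∀ (K : Type) [Field K] [NumberField K], Prop :=
  fun K _ _ => NumberField.IsTotallyReal K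

/-- `K` is imaginary quadratic: totally complex of degree `2` (the summit's convention, cf. routes
`ImaginaryQuadraticAnchor`, `FifteenLocusEisenstein`). [folklore] -/
def IsImaginaryQuadratic (K : Type) [Field K] [NumberField K] : Prop :=
  NumberField.IsTotallyComplex K ∧ Module.finrank ℚ K = 2

/-- The rung's class: totally real OR imaginary quadratic. [folklore] -/
def TotallyRealOrImagQuadClass : ∀ (K : Type) [Field K] [NumberField K], Prop :=
  fun K _ _ => NumberField.IsTotallyReal K ∨ IsImaginaryQuadratic K

/-! ## 2. The rung family (clause (B), `Symᵐ`-sector of regular algebraic `π` on `GL₂`, a.e.-Satake form) -/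

/-- **Clause (B) on the `Symᵐ`-sector of regular algebraic cuspidal `π` on `GL₂(𝔸_K)`** (one degree `m`, one
field `K`): for every regular algebraic cuspidal `π` on `GL₂(𝔸_K)`, every prime `ℓ`, `ι : ℚ̄_ℓ ≃+* ℂ` and every
IRREDUCIBLE `ρ : Γ_K → GL_{m+1}(ℚ̄_ℓ)` that is de Rham above `ℓ` (pinned Fontaine datum) and whose arithmetic
Frobenius at a.e. finite place `v` has characteristic polynomial the `ι`-Satake polynomial of
`Symᵐ{a, b} = symmPowerParams m a b`, `{a, b}` the Satake pair of `π_v`: there is an automorphic representation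
`P` of `GL_{m+1}(𝔸_K)` (Borel–Jacquet datum) Satake–Frobenius compatible with `ρ` at a.e. `v`. -/
def SymmPowerRASectorB (m : ℕ) (K : Type) [Field K] [NumberField K] : Prop :=
  ∀ (h2 : isCompact_glFiniteIntegralLevel 2 K) (π : CuspidalAutomorphicRepData 2 K h2),
    π.1.IsRegularAlgebraic →
    ∀ (ℓ : ℕ) [Fact ℓ.Prime] (ι : PadicAlgCl ℓ ≃+* ℂ) (ρ : FramedGaloisRep K (PadicAlgCl ℓ) (m + 1)),
      ρ.toGaloisRep.IsIrreducible →
      (∀ (v : HeightOneSpectrum (𝓞 K)) (hv : ((ℓ : ℕ) : 𝓞 K) ∈ v.asIdeal),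
          (fontainePstAdicCompletion v ℓ hv).IsDeRhamFramed (ρ.toLocal v)) →
      (∀ᶠ v : HeightOneSpectrum (𝓞 K) in cofinite, ∃ a b : ℂ, π.1.HasSatakeParamAt v {a, b} ∧
          ρ.IsUnramifiedAt v ∧
          ρ.HasFrobCharpolyAt v (arithFrobPolyOfSatake ι v.residueCard 1 (symmPowerParams m a b))) →
      ∀ hm : isCompact_glFiniteIntegralLevel (m + 1) K,
        ∃ P : AutomorphicRepData (AutomorphyDatum.gl (m + 1) K hm),
          ∀ᶠ v : HeightOneSpectrum (𝓞 K) in cofinite, SatakeFrobCompatibleAt ι P ρ v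

/-- **The RUNG FAMILY over a class `𝒦` of number fields**: all degrees `m ≥ 1` over every field of the class. -/
def SymmPowerRAGaloisToAutomorphicOn (𝒦 : ∀ (K : Type) [Field K] [NumberField K], Prop) : Prop :=
  ∀ (K : Type) [Field K] [NumberField K], 𝒦 K → ∀ m : ℕ, 1 ≤ m → SymmPowerRASectorB m K

/-- **THE RUNG** (the filed statement): the family over the class "totally real or imaginary quadratic" —
the new (open) cell is `Symᵐ`, `m ≥ 5`, of genuinely Bianchi regular algebraic cuspidal `π`. -/
-- @[stub "BianchiSymmPowerGaloisToAutomorphic"]   (live in the registration copy; crux workfiles carry no gate-reserved attributes)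
def BianchiSymmPowerGaloisToAutomorphic : Prop :=
  SymmPowerRAGaloisToAutomorphicOn TotallyRealOrImagQuadClass

/-- Class monotonicity: a bigger class gives a stronger statement. [folklore] -/
theorem symmPowerRAGaloisToAutomorphicOn_mono {𝒦 𝒦' : ∀ (K : Type) [Field K] [NumberField K], Prop}
    (h𝒦 : ∀ (K : Type) [Field K] [NumberField K], 𝒦 K → 𝒦' K)
    (h : SymmPowerRAGaloisToAutomorphicOn 𝒦') : SymmPowerRAGaloisToAutomorphicOn 𝒦 :=
  fun K _ _ hK => h K (h𝒦 K hK)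

/-- The rung implies the floor's family value (totally real ⊆ totally real ∪ imaginary quadratic): the ladder is
ordered. [folklore] -/
@[aesop safe apply]
theorem floorFamily_of_rung (h : BianchiSymmPowerGaloisToAutomorphic) :
    SymmPowerRAGaloisToAutomorphicOn TotallyRealClass :=
  symmPowerRAGaloisToAutomorphicOn_mono (fun _ _ _ hK => Or.inl hK) h

/-! ## 3. The floor (F3 witness) and the side floors -/

/-- **Newton–Thorne 2022, Thm. A + footnote 1** (datum-model a.e. rendering): for `F` totally real and `π` a
regular algebraic cuspidal automorphic representation of `GL₂(𝔸_F)` (= "`π_∞` essentially square-integrable" and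
algebraic, i.e. a cuspidal Hilbert eigenform of weights `k_v ≥ 2`), every `Symᵐ π`, `m ≥ 1`, exists as an
automorphic representation of `GL_{m+1}(𝔸_F)` with the `Symᵐ` Satake parameters at a.e. place (cuspidal when `π`
is not CM, Thm. A; by Eisenstein series when `π` is CM, footnote 1).  Text, used as a hypothesis; the `F = ℚ`
cell is the tree's `L²`-model fact `NewtonThorne2021_exists_cuspidal_symmPowerLift`.
[cite: arXiv:2212.03595, Thm. A (p. 3) and footnote 1] -/
def NewtonThorne2022SymmPowerText : Prop :=
  ∀ (F : Type) [Field F] [NumberField F] [NumberField.IsTotallyReal F]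
    (h2 : isCompact_glFiniteIntegralLevel 2 F) (π : CuspidalAutomorphicRepData 2 F h2),
    π.1.IsRegularAlgebraic → ∀ (m : ℕ), 1 ≤ m → ∀ (hm : isCompact_glFiniteIntegralLevel (m + 1) F),
      ∃ P : AutomorphicRepData (AutomorphyDatum.gl (m + 1) F hm), IsSymmPowerLiftAE m π.1 P

/-- An a.e. `Symᵐ`-lift of `π` settles clause (B) on the `Symᵐ`-sector of `π` (the bridge of generation 7,
with the regular-algebraic hypothesis carried along). [folklore] -/
theorem sectorB_of_exists_lift (m : ℕ) {K : Type} [Field K] [NumberField K]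
    (h : ∀ (h2 : isCompact_glFiniteIntegralLevel 2 K) (π : CuspidalAutomorphicRepData 2 K h2),
      π.1.IsRegularAlgebraic → ∀ (hm : isCompact_glFiniteIntegralLevel (m + 1) K),
        ∃ P : AutomorphicRepData (AutomorphyDatum.gl (m + 1) K hm), IsSymmPowerLiftAE m π.1 P) :
    SymmPowerRASectorB m K := by
  intro h2 π hRA ℓ _ ι ρ _ _ hsym hm
  obtain ⟨P, hP⟩ := h h2 π hRA hm
  refine ⟨P, ?_⟩
  filter_upwards [hsym, hP] with v hv hPv
  obtain ⟨a, b, hπ, hur, hcp⟩ := hv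
  exact ⟨symmPowerParams m a b, hPv a b hπ, hur, hcp⟩

/-- **FLOOR BRIDGE (F3)**: Newton–Thorne 2022 gives the family over the class of totally real fields. -/
theorem floor_newtonThorne (h : NewtonThorne2022SymmPowerText) :
    SymmPowerRAGaloisToAutomorphicOn TotallyRealClass := by
  intro K _ _ hK m hm
  haveI : NumberField.IsTotallyReal K := hK
  exact sectorB_of_exists_lift m fun h2 π hRA hmK => h K h2 π hRA m hm hmK

/-- F3 literal: the floor value of the family specialises to the cited theorem. -/
example (h : NewtonThorne2022SymmPowerText) : SymmPowerRAGaloisToAutomorphicOn TotallyRealClass :=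
  floor_newtonThorne h

/-- **Side floors** (print-decided cells INSIDE the rung and above it): weak `Symᵐ` functoriality in degree `m`
over every number field settles the degree-`m` cell over every field. [folklore] -/
theorem sectorB_of_weakSymmPowerFunctoriality (m : ℕ) (h : WeakSymmPowerFunctoriality m)
    (K : Type) [Field K] [NumberField K] : SymmPowerRASectorB m K :=
  sectorB_of_exists_lift m fun h2 π _ hm => h K h2 hm π

/-- `m = 1` is tautological over every field. [folklore] -/
theorem sectorB_one (K : Type) [Field K] [NumberField K] : SymmPowerRASectorB 1 K :=
  sectorB_of_weakSymmPowerFunctoriality 1 weakSymmPowerFunctoriality_one K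

/-- `m = 2` over every field: Gelbart–Jacquet 1978 (in-tree named fact). -/
theorem sectorB_two (hGJ : GelbartJacquet_symmSq_automorphic) (K : Type) [Field K] [NumberField K] :
    SymmPowerRASectorB 2 K :=
  sectorB_of_weakSymmPowerFunctoriality 2 (weakSymmPowerFunctoriality_two_of_GelbartJacquet hGJ) K

/-- `m = 3` over every field: Kim–Shahidi 2002 (in-tree text). -/
theorem sectorB_three (h : KimShahidi2002_symmCube_automorphic) (K : Type) [Field K] [NumberField K] :
    SymmPowerRASectorB 3 K :=
  sectorB_of_weakSymmPowerFunctoriality 3 h K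

/-- `m = 4` over every field: Kim 2003 (in-tree text). -/
theorem sectorB_four (h : Kim2003_symmFourth_automorphic) (K : Type) [Field K] [NumberField K] :
    SymmPowerRASectorB 4 K :=
  sectorB_of_weakSymmPowerFunctoriality 4 h K

/-! ## 4. On-path (F4): the summit, and the crux E itself, give every class — in particular the rung -/

/-- Clause (B) at rank `m + 1` for one reciprocity datum gives the degree-`m` cell. [folklore] -/
theorem sectorB_of_galoisToAutomorphic (m : ℕ) {K : Type} [Field K] [NumberField K]
    (Rec : ReciprocityData K)
    (hB : ∀ hcpt : isCompact_glFiniteIntegralLevel (m + 1) K, GaloisToAutomorphic (m + 1) Rec hcpt) :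
    SymmPowerRASectorB m K := by
  intro h2 π _ ℓ _ ι ρ hirr hdR hsym hm
  have hgeo : IsGeometricFramed Rec ρ :=
    ⟨hsym.mono fun v hv => by obtain ⟨_, _, _, hur, _⟩ := hv; exact hur, fun v hv => hdR v hv⟩
  obtain ⟨P, -, hcorr⟩ := hB hm ℓ ι ρ hirr hgeo
  exact ⟨P.1, hcorr.1⟩

/-- `Langlands → SymmPowerRAGaloisToAutomorphicOn 𝒦` for every class `𝒦`. -/
theorem symmPowerRAGaloisToAutomorphicOn_of_langlands (𝒦 : ∀ (K : Type) [Field K] [NumberField K], Prop)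
    (hL : _root_.Langlands) : SymmPowerRAGaloisToAutomorphicOn 𝒦 := by
  intro K _ _ _ m _
  obtain ⟨⟨Rec⟩, hall⟩ := hL K
  exact sectorB_of_galoisToAutomorphic m Rec fun hcpt => (hall Rec (m + 1) (Nat.succ_pos m) hcpt).2

/-- **F4 on-path lemma for the rung**: `Langlands → BianchiSymmPowerGaloisToAutomorphic`. -/
@[aesop safe apply]
theorem BianchiSymmPowerGaloisToAutomorphic_of_Langlands (hL : _root_.Langlands) :
    BianchiSymmPowerGaloisToAutomorphic :=
  symmPowerRAGaloisToAutomorphicOn_of_langlands _ hL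

/-- `E → SymmPowerRAGaloisToAutomorphicOn 𝒦` (clause (B) of E for its own `Rec`). -/
theorem symmPowerRAGaloisToAutomorphicOn_of_top (𝒦 : ∀ (K : Type) [Field K] [NumberField K], Prop)
    (hE : Summit.Langlands.Langlands.Theses.OrdinaryPrimeTransport.ReciprocityUpToIrreducibility) :
    SymmPowerRAGaloisToAutomorphicOn 𝒦 := by
  intro K _ _ _ m _
  obtain ⟨Rec, hall⟩ := hE K
  exact sectorB_of_galoisToAutomorphic m Rec fun hcpt => (hall (m + 1) (Nat.succ_pos m) hcpt).2

/-- `E → rung`. -/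
theorem BianchiSymmPowerGaloisToAutomorphic_of_top
    (hE : Summit.Langlands.Langlands.Theses.OrdinaryPrimeTransport.ReciprocityUpToIrreducibility) :
    BianchiSymmPowerGaloisToAutomorphic :=
  symmPowerRAGaloisToAutomorphicOn_of_top _ hE

/-! ## 5. The sector, its merge target and the off-sector complement -/

/-- **The `Symᵐ`-RA sector of clause (B)**: `ρ : Γ_F → GL_n(ℚ̄_ℓ)` has `n = m + 1` with `m ≥ 1` and, for some
regular algebraic cuspidal `π` on `GL₂(𝔸_F)`, a.e. Frobenius polynomial the `ι`-Satake polynomial of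
`Symᵐ(Satake(π_v))`. -/
def InSymmPowerRASector (F : Type) [Field F] [NumberField F] (ℓ : ℕ) [Fact ℓ.Prime]
    (ι : PadicAlgCl ℓ ≃+* ℂ) {n : ℕ} (ρ : FramedGaloisRep F (PadicAlgCl ℓ) n) : Prop :=
  ∃ m : ℕ, 1 ≤ m ∧ n = m + 1 ∧
    ∃ (h2 : isCompact_glFiniteIntegralLevel 2 F) (π : CuspidalAutomorphicRepData 2 F h2),
      π.1.IsRegularAlgebraic ∧
      ∀ᶠ v : HeightOneSpectrum (𝓞 F) in cofinite, ∃ a b : ℂ, π.1.HasSatakeParamAt v {a, b} ∧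
        ρ.IsUnramifiedAt v ∧
        ρ.HasFrobCharpolyAt v (arithFrobPolyOfSatake ι v.residueCard 1 (symmPowerParams m a b))

/-- **Merge target**: clause (B) of E VERBATIM (cuspidal, L-algebraic, `Corresponds Rec ι π ρ`) for EVERY
reciprocity datum `Rec`, on the `Symᵐ`-RA sector. -/
def SectorGaloisToAutomorphic : Prop :=
  ∀ (F : Type) [Field F] [NumberField F] (Rec : ReciprocityData F) (n : ℕ), 0 < n →
    ∀ (hcpt : isCompact_glFiniteIntegralLevel n F) (ℓ : ℕ) [Fact ℓ.Prime] (ι : PadicAlgCl ℓ ≃+* ℂ)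
      (ρ : FramedGaloisRep F (PadicAlgCl ℓ) n),
      ρ.toGaloisRep.IsIrreducible → IsGeometricFramed Rec ρ → InSymmPowerRASector F ℓ ι ρ →
        ∃ π : CuspidalAutomorphicRepData n F hcpt, π.1.IsLAlgebraic ∧ Corresponds Rec ι π.1 ρ

/-- **The off-sector complement**: E with clause (A) entire and clause (B) restricted to `ρ` NOT in the
`Symᵐ`-RA sector. -/
-- @[stub "BianchiSymmPowerGaloisToAutomorphic"]   (live in the registration copy; crux workfiles carry no gate-reserved attributes)
def OffSectorReciprocity : Prop :=
  ∀ (F : Type) [Field F] [NumberField F], ∃ Rec : ReciprocityData F, ∀ n : ℕ, 0 < n →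
    ∀ hcpt : isCompact_glFiniteIntegralLevel n F,
      (∀ π : CuspidalAutomorphicRepData n F hcpt, π.1.IsLAlgebraic →
        ∀ (ℓ : ℕ) [Fact ℓ.Prime] (ι : PadicAlgCl ℓ ≃+* ℂ),
          ∃ ρ : FramedGaloisRep F (PadicAlgCl ℓ) n, IsGeometricFramed Rec ρ ∧ Corresponds Rec ι π.1 ρ) ∧
      (∀ (ℓ : ℕ) [Fact ℓ.Prime] (ι : PadicAlgCl ℓ ≃+* ℂ) (ρ : FramedGaloisRep F (PadicAlgCl ℓ) n),
        ρ.toGaloisRep.IsIrreducible → IsGeometricFramed Rec ρ → ¬ InSymmPowerRASector F ℓ ι ρ →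
          ∃ π : CuspidalAutomorphicRepData n F hcpt, π.1.IsLAlgebraic ∧ Corresponds Rec ι π.1 ρ)

/-- **The cells above the rung**: the family over every number field OUTSIDE the rung's class (CM fields of
degree `≥ 4`: Newton–Thorne 2022 Thm. 41 covers the conjugate-self-dual-up-to-twist `π`, the rest is open with
only potential automorphy; fields neither totally real nor CM: no method). -/
-- @[stub "BianchiSymmPowerGaloisToAutomorphic"]   (live in the registration copy; crux workfiles carry no gate-reserved attributes)
def HigherRungs : Prop :=
  SymmPowerRAGaloisToAutomorphicOn (fun K _ _ => ¬ (NumberField.IsTotallyReal K ∨ IsImaginaryQuadratic K))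

/-- Rung + the cells above it = the family over ALL number fields (sorry-free glue). [folklore] -/
theorem family_all_of (hr : BianchiSymmPowerGaloisToAutomorphic) (hh : HigherRungs) :
    SymmPowerRAGaloisToAutomorphicOn (fun _ _ _ => True) := by
  intro K _ _ _
  by_cases hK : NumberField.IsTotallyReal K ∨ IsImaginaryQuadratic K
  · exact hr K hK
  · exact hh K hK

/-- **Sector-merge step** (obligation node): from a.e.-Satake automorphy on the whole `Symᵐ`-RA sector to clause
(B) of E verbatim on that sector, for every reciprocity datum `Rec`. -/
-- @[stub "BianchiSymmPowerGaloisToAutomorphic"]   (live in the registration copy; crux workfiles carry no gate-reserved attributes)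
def SectorMergeStep : Prop :=
  SymmPowerRAGaloisToAutomorphicOn (fun _ _ _ => True) → SectorGaloisToAutomorphic

/-! ## 6. The four registered stubs (one per obligation node) -/

/-- **THE RUNG** (open).  Located stop: Newton–Thorne's analytic continuation of `Symᵐ`-automorphy along
eigenvariety components (arXiv:2212.03595 §2, Thm. 2.33; needs a definite-unitary / polarizable setting and
components of the dimension of weight space) has no Bianchi analogue (components of dimension 1 in a
2-dimensional weight space, finitely many classical points; `Symᵐ r_π` not polarizable); the defect-positive
lifting theorems (BCGNT arXiv:2309.15880 Thm. 3.2.1) need RESIDUAL automorphy of `Symᵐ r̄_{π,λ}` over `K` itself,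
known in print only over an extension `K'/K`. -/
theorem stub_rung : BianchiSymmPowerGaloisToAutomorphic := by
  sorry

/-- **The higher rungs** (CM fields of degree `≥ 4`; then every number field). -/
theorem stub_higherRungs : HigherRungs := by
  sorry

/-- Sector merge: from a.e.-Satake automorphy on the `Symᵐ`-RA sector to clause (B) of E verbatim on the
sector, for every `Rec` (strong multiplicity one / isobaric rigidity ⇒ the cuspidal `π`; L-algebraicity;
local–global compatibility at every finite place against the pinned data). -/
theorem stub_sectorMerge : SectorMergeStep := by
  sorry

/-- The honest complement: E off the `Symᵐ`-RA sector. -/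
theorem stub_offSector : OffSectorReciprocity := by
  sorry

/-! ## 7. Composition (no sorry below this line) -/

/-- **COMPOSITION — the crux BY NAME from the four stub statements** (the `OrdinaryPrimeTransport` copy of the
decl; the registration copy concludes the `Iff.rfl`-equal primary `IrreducibilityBySelfDuality` decl with the same proof). -/
theorem ReciprocityUpToIrreducibility_of :
    BianchiSymmPowerGaloisToAutomorphic → HigherRungs → SectorMergeStep → OffSectorReciprocity →
    Summit.Langlands.Langlands.Theses.OrdinaryPrimeTransport.ReciprocityUpToIrreducibility := by
  intro hr hh hmerge hoff F _ _
  obtain ⟨Rec, hall⟩ := hoff F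
  refine ⟨Rec, fun n hn hcpt => ⟨(hall n hn hcpt).1, ?_⟩⟩
  intro ℓ _ ι ρ hirr hgeo
  by_cases hsec : InSymmPowerRASector F ℓ ι ρ
  · exact hmerge (family_all_of hr hh) F Rec n hn hcpt ℓ ι ρ hirr hgeo hsec
  · exact (hall n hn hcpt).2 ℓ ι ρ hirr hgeo hsec

/-- **THE SKELETON THEOREM** — the item's decl BY NAME from the four stubs. -/
theorem reciprocityUpToIrreducibility_of_stubs :
    Summit.Langlands.Langlands.Theses.OrdinaryPrimeTransport.ReciprocityUpToIrreducibility :=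
  ReciprocityUpToIrreducibility_of stub_rung stub_higherRungs stub_sectorMerge stub_offSector

end Summit.Langlands.Langlands.Cruxes.ReciprocityUpToIrreducibility.BianchiSymmPowerGaloisToAutomorphic

end
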